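import Mathlib
import Summits.Ventures.PercRepro2.HMFPendantB
import Summits.Ventures.PercRepro2.PendantBSideBound

/-!
# (ATT-b) is a theorem: (HCOV) at a pendant `a₃` at `b` holds outright (blind cell PercRepro2,
mine-2 g55, 2026-08-30; `conjectures/MINE-2.md` M2-119 addendum)

night-1 g6's `HMFPendantB.lean` reduced (HCOV) at a pendant `a₃` at `b` to the first-order
attachment functional (ATT-b)

  `attB = (Z + B_L)·s_LH + (Z + B_H)·s_HL − B_H·s_LL − B_L·s_HH ≥ 0`

(`s_LH = A_L B_H − Z x_LH`, `s_HL` the two BHK 1.4 cross-cluster slacks, `s_LL = Z x_LL − A_L B_L`,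
`s_HH` the two van den Berg–Kahn same-side slacks of the `a₃`-free `Q`-law; census 0 / 584), through
the mean field and the diagonal theorem `DiagBA3.Gc_diag3_nonneg`.  The same-side / cross-side
bound of `PendantBSideBound.lean` (`same_side_le_cross`: `B_H·s_LL ≤ Z·s_LH`, and its mirror
`B_L·s_HH ≤ Z·s_HL`) gives **`attB_nonneg`**: `attB ≥ B_L·s_LH + B_H·s_HL ≥ 0`.  Hence

  **`HCov_pendant_a3_at_b_unconditional`**: (HCOV) holds at every instance with `a₃` a leaf at `b`,

with no (HCOV) hypothesis at all (the pendant-`a₃`-at-`b` class is not merely reducible but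
closed), and the rule `HCov_pendant_a3_at_b` of `PendantA3BHCov.lean` is superseded there.
Own work; standard axioms.
-/

namespace Summit.Ventures.PercRepro2

namespace CovForm

namespace SideBound

section Att

variable {V : Type*} {E : Type*} [Fintype E] [DecidableEq E] [Fintype V] [DecidableEq V]
  {R : Type*} [Field R] [LinearOrder R] [IsStrictOrderedRing R]

omit [Fintype E] [DecidableEq E] [Fintype V] [DecidableEq V] [LinearOrder R] [IsStrictOrderedRing R] in
/-- Reordering an intersection of three events. -/
lemma inter_three_comm (Q A B : Set (Config E)) : Q ∩ A ∩ B = Q ∩ (B ∩ A) := by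
  ext ω
  simp only [Set.mem_inter_iff]
  tauto

/-- **(ATT-b) is nonnegative**: `attB ≥ B_L·s_LH + B_H·s_HL ≥ 0` by the same-side / cross-side
bound and its mirror. -/
theorem attB_nonneg (p : E → R) (hp : IsProbVec p) (ends : E → Sym2 V) (o a₁ a₂ b : V) :
    0 ≤ HMFPendantB.attB p ends o a₁ a₂ b := by
  have h1 := same_side_le_cross p hp ends o a₁ a₂ b
  have h2 := same_side_le_cross_mirror p hp ends o a₁ a₂ b
  have h3 := cross_whole p hp ends o a₁ a₂ b
  have h4 := cross_whole_mirror p hp ends o a₁ a₂ b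
  have hA := prob_nonneg hp (avoidAll ends a₂ {a₁} ∩ connEvent ends a₂ b)
  have hB := prob_nonneg hp (avoidAll ends a₂ {a₁} ∩ connEvent ends a₁ b)
  simp only [HMFPendantB.attB]
  rw [inter_three_comm (avoidAll ends a₂ {a₁}) (connEvent ends a₁ b) (connEvent ends a₁ o),
    inter_three_comm (avoidAll ends a₂ {a₁}) (connEvent ends a₂ b) (connEvent ends a₁ o),
    inter_three_comm (avoidAll ends a₂ {a₁}) (connEvent ends a₁ b) (connEvent ends a₂ o),
    inter_three_comm (avoidAll ends a₂ {a₁}) (connEvent ends a₂ b) (connEvent ends a₂ o)]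
  nlinarith [mul_nonneg hB (sub_nonneg.2 h3), mul_nonneg hA (sub_nonneg.2 h4)]

/-- **(HCOV) at a pendant `a₃` at `b`, outright**: for `f = {a₃, b}` the only edge at `a₃` and every
admissible weight vector, `HCov p` holds with no hypothesis on smaller instances. -/
theorem HCov_pendant_a3_at_b_unconditional (p : E → R) (hp : IsProbVec p) (ends : E → Sym2 V)
    {f : E} {a₃ b : V} (hf : ends f = s(a₃, b)) (hleaf : ∀ e, a₃ ∈ ends e → e = f) (h3b : a₃ ≠ b)
    {o a₁ a₂ : V} (h31 : a₃ ≠ a₁) (h32 : a₃ ≠ a₂) (ho : o ≠ a₃) : HCov p ends o a₁ a₂ a₃ b :=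
  HMFPendantB.HCov_pendant_b p ends hp hf hleaf h3b h31 h32 ho (attB_nonneg p hp ends o a₁ a₂ b)

end Att

end SideBound

end CovForm

end Summit.Ventures.PercRepro2
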